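import Summits.CriticalPhenomena.PercolationContinuityZ3.Theorems.SahiMasterFamilyHSharp

/-!
# H♯(3) holds: `Φ_3(cap_0 β) + Φ_3(cap_1 β) + Φ_3(cap_2 β) ≤ 3·Φ_3(β)` on the union-closed hull (indeed on the linear relaxation `F^UC(3)`)

Unit `prim-masterthm-p4` (gen 17; crux anchor stmt-CriticalPhenomena-4575, helper work; memo
`run/shared/lean/prim/prim-masterthm/prim-masterthm-p4/P4-GEN17-REPORT.md` §3).  Companion of `…HSharp` (the typed conjecture `HSharpNonneg k`,
`HSharpNonneg k → UCHullNonneg k`, the vertex case, `k ≤ 2`).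

**THEOREM `hSharpNonneg_three : HSharpNonneg 3`** — the first order at which H♯ is not trivial.  With `a,b,c = β_{0},β_{1},β_{2}`,
`p,q,r = β_{12},β_{02},β_{01}` and `β_univ = 1`:  `3Φ_3(β) − Σ_t Φ_3(cap_t β) = 2(a+b+c) − (ab+ac+bc) + 3abc + p(1−3a) + q(1−3b) + r(1−3c)`,
which is `≥ 0` on the box under the three pairwise-union inequalities `b + c ≤ 1 + p`, `a + c ≤ 1 + q`, `a + b ≤ 1 + r` (`hsharp_three_poly`:
the expression is affine in each of `p, q, r`, so it suffices to check the endpoints `p ∈ {max(0, b+c−1), 1}` according to the sign of `1 − 3a`;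
eight sign cases, each closed by `nlinarith`).  Every mixture of union-closed indicator functions satisfies these inequalities pointwise
(`[S∈𝒰] + [T∈𝒰] ≤ 1 + [S∪T∈𝒰]`), as in `…UCHullFour`.  NOTE: from `k = 5` on H♯ is FALSE on the linear relaxation (memo §3), so this
box-plus-pairwise argument is specific to the smallest orders.  HONEST FRAMING: H♯(k) for k ≥ 4, (UC-hull)_k for k ≥ 8, Sahi's `C_k`,
Kahn's Conjecture 5 and the master theorem remain OPEN.  Axioms standard. [this work]
-/

noncomputable section

open scoped Classical

namespace Summit.CriticalPhenomena.PercolationContinuityZ3.Theorems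

namespace HSharp

open Finset
open Literature.Combinatorics.Sahi2008
open PrincipalCapBeta (phiSet)

/-- **The polynomial heart of H♯(3)**: on the box `[0,1]^6` with the three pairwise-union inequalities,
`0 ≤ 2(a+b+c) − (ab+ac+bc) + 3abc + p(1−3a) + q(1−3b) + r(1−3c)`. [this work] -/
theorem hsharp_three_poly (a b c p q r : ℝ) (ha0 : 0 ≤ a) (ha1 : a ≤ 1) (hb0 : 0 ≤ b) (hb1 : b ≤ 1) (hc0 : 0 ≤ c) (hc1 : c ≤ 1)
    (hp0 : 0 ≤ p) (hp1 : p ≤ 1) (hq0 : 0 ≤ q) (hq1 : q ≤ 1) (hr0 : 0 ≤ r) (hr1 : r ≤ 1)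
    (hpu : b + c ≤ 1 + p) (hqu : a + c ≤ 1 + q) (hru : a + b ≤ 1 + r) :
    0 ≤ 2 * (a + b + c) - (a * b + a * c + b * c) + 3 * a * b * c + p * (1 - 3 * a) + q * (1 - 3 * b) + r * (1 - 3 * c) := by
  have e1 := mul_nonneg (mul_nonneg (sub_nonneg.2 ha1) (sub_nonneg.2 hb1)) (sub_nonneg.2 hc1)
  have e2 := mul_nonneg (mul_nonneg ha0 (sub_nonneg.2 hb1)) (sub_nonneg.2 hc1)
  have e3 := mul_nonneg (mul_nonneg hb0 (sub_nonneg.2 ha1)) (sub_nonneg.2 hc1)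
  have e4 := mul_nonneg (mul_nonneg hc0 (sub_nonneg.2 ha1)) (sub_nonneg.2 hb1)
  have e5 := mul_nonneg (mul_nonneg ha0 hb0) (sub_nonneg.2 hc1)
  have e6 := mul_nonneg (mul_nonneg ha0 hc0) (sub_nonneg.2 hb1)
  have e7 := mul_nonneg (mul_nonneg hb0 hc0) (sub_nonneg.2 ha1)
  have e8 := mul_nonneg (mul_nonneg ha0 hb0) hc0
  have f1 := mul_nonneg (sub_nonneg.2 ha1) (sub_nonneg.2 hb1)
  have f2 := mul_nonneg (sub_nonneg.2 ha1) (sub_nonneg.2 hc1)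
  have f3 := mul_nonneg (sub_nonneg.2 hb1) (sub_nonneg.2 hc1)
  rcases le_total (3 * a) 1 with ha | ha <;> rcases le_total (3 * b) 1 with hb | hb <;> rcases le_total (3 * c) 1 with hc | hc
  · nlinarith [mul_nonneg hp0 (sub_nonneg.2 ha), mul_nonneg hq0 (sub_nonneg.2 hb), mul_nonneg hr0 (sub_nonneg.2 hc)]
  · nlinarith [mul_nonneg hp0 (sub_nonneg.2 ha), mul_nonneg hq0 (sub_nonneg.2 hb), mul_nonneg (sub_nonneg.2 hr1) (sub_nonneg.2 hc)]
  · nlinarith [mul_nonneg hp0 (sub_nonneg.2 ha), mul_nonneg (sub_nonneg.2 hq1) (sub_nonneg.2 hb), mul_nonneg hr0 (sub_nonneg.2 hc)]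
  · nlinarith [mul_nonneg (sub_nonneg.2 (by linarith : b + c - 1 ≤ p)) (sub_nonneg.2 ha), mul_nonneg hp0 (sub_nonneg.2 ha),
      mul_nonneg (sub_nonneg.2 hq1) (sub_nonneg.2 hb), mul_nonneg (sub_nonneg.2 hr1) (sub_nonneg.2 hc)]
  · nlinarith [mul_nonneg (sub_nonneg.2 hp1) (sub_nonneg.2 ha), mul_nonneg hq0 (sub_nonneg.2 hb), mul_nonneg hr0 (sub_nonneg.2 hc)]
  · nlinarith [mul_nonneg (sub_nonneg.2 hp1) (sub_nonneg.2 ha), mul_nonneg (sub_nonneg.2 (by linarith : a + c - 1 ≤ q)) (sub_nonneg.2 hb),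
      mul_nonneg hq0 (sub_nonneg.2 hb), mul_nonneg (sub_nonneg.2 hr1) (sub_nonneg.2 hc)]
  · nlinarith [mul_nonneg (sub_nonneg.2 hp1) (sub_nonneg.2 ha), mul_nonneg (sub_nonneg.2 hq1) (sub_nonneg.2 hb),
      mul_nonneg (sub_nonneg.2 (by linarith : a + b - 1 ≤ r)) (sub_nonneg.2 hc), mul_nonneg hr0 (sub_nonneg.2 hc)]
  · nlinarith [mul_nonneg (sub_nonneg.2 hp1) (sub_nonneg.2 ha), mul_nonneg (sub_nonneg.2 hq1) (sub_nonneg.2 hb),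
      mul_nonneg (sub_nonneg.2 hr1) (sub_nonneg.2 hc)]

/-- **H♯(3) on the box under the pairwise-union inequalities**: `Σ_t Φ_3(cap_t β) ≤ 3·Φ_3(β)` for every `0 ≤ β ≤ 1` with `β_univ = 1` and
`β_S + β_T ≤ 1 + β_{S∪T}`. [this work] -/
theorem hSharp_three_of_pairUnion (β : Finset (Fin 3) → ℝ) (h0 : ∀ B, 0 ≤ β B) (h1 : ∀ B, β B ≤ 1) (huniv : β univ = 1)
    (hu : ∀ S T : Finset (Fin 3), β S + β T ≤ 1 + β (S ∪ T)) :
    ∑ t : Fin 3, phiSet 3 (fun S => if t ∈ S then 1 else β S) ≤ (3 : ℝ) * phiSet 3 β := by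
  have key := hsharp_three_poly (β {0}) (β {1}) (β {2}) (β {1, 2}) (β {0, 2}) (β {0, 1})
    (h0 _) (h1 _) (h0 _) (h1 _) (h0 _) (h1 _) (h0 _) (h1 _) (h0 _) (h1 _) (h0 _) (h1 _)
    (by have := hu {1} {2}; simpa using this) (by have := hu {0} {2}; simpa using this) (by have := hu {0} {1}; simpa using this)
  simp only [PrincipalCapBeta.phiSet_three, Fin.sum_univ_three, Fin.isValue, mem_univ, if_true, mem_insert, mem_singleton,
    huniv]
  norm_num [Fin.ext_iff]
  nlinarith [key]

/-- **H♯(3)** (`HSharpNonneg 3`): every mixture of union-closed indicator functions containing `univ` lies in the box, has top value one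
and satisfies every pairwise-union inequality. [this work] -/
theorem hSharpNonneg_three : HSharpNonneg 3 := by
  intro α _ w 𝒰 hw0 hw1 hUC htop
  set β : Finset (Fin 3) → ℝ := fun S => ∑ x, w x * (if S ∈ 𝒰 x then (1 : ℝ) else 0) with hβ
  have h0 : ∀ B, 0 ≤ β B := fun B => sum_nonneg fun x _ => mul_nonneg (hw0 x) (by split_ifs <;> norm_num)
  have h1 : ∀ B, β B ≤ 1 := fun B => mixture_le_one w 𝒰 hw0 hw1 B
  have huniv : β univ = 1 := by
    have : ∀ x, w x * (if (univ : Finset (Fin 3)) ∈ 𝒰 x then (1 : ℝ) else 0) = w x := fun x => by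
      rw [if_pos (htop x), mul_one]
    simp only [hβ, this, hw1]
  have hu : ∀ S T : Finset (Fin 3), β S + β T ≤ 1 + β (S ∪ T) := by
    intro S T
    have hpt : ∀ x, w x * (if S ∈ 𝒰 x then (1 : ℝ) else 0) + w x * (if T ∈ 𝒰 x then (1 : ℝ) else 0) ≤
        w x * 1 + w x * (if S ∪ T ∈ 𝒰 x then (1 : ℝ) else 0) := by
      intro x
      rw [← mul_add, ← mul_add]
      refine mul_le_mul_of_nonneg_left ?_ (hw0 x)
      by_cases hS : S ∈ 𝒰 x
      · by_cases hT : T ∈ 𝒰 x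
        · rw [if_pos hS, if_pos hT, if_pos (hUC x S hS T hT)]
        · rw [if_pos hS, if_neg hT]; split_ifs <;> norm_num
      · rw [if_neg hS]; split_ifs <;> norm_num
    calc β S + β T = ∑ x, (w x * (if S ∈ 𝒰 x then (1 : ℝ) else 0) + w x * (if T ∈ 𝒰 x then (1 : ℝ) else 0)) := by
          rw [hβ, ← sum_add_distrib]
      _ ≤ ∑ x, (w x * 1 + w x * (if S ∪ T ∈ 𝒰 x then (1 : ℝ) else 0)) := sum_le_sum fun x _ => hpt x
      _ = 1 + β (S ∪ T) := by rw [sum_add_distrib, ← sum_mul, hw1, one_mul]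
  show ∑ t : Fin 3, phiSet 3 (fun S => if t ∈ S then 1 else β S) ≤ ((3 : ℕ) : ℝ) * phiSet 3 β
  exact_mod_cast hSharp_three_of_pairUnion β h0 h1 huniv hu

/-- Down the ladder again: a fourth proof of `(UC-hull)_3` (after `GHConjecture.ucHullNonneg_three`). [this work] -/
theorem ucHullNonneg_three' : GHConjecture.UCHullNonneg 3 :=
  ucHullNonneg_of_hSharpNonneg hSharpNonneg_three

end HSharp

end Summit.CriticalPhenomena.PercolationContinuityZ3.Theorems
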